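/-
Copyright (c) 2026 the pub-hodgecm-mathlib formalisation cell (harness21).  Prover seat hodgecm-mathlib-K2E3-p32 (g0), HCML Track B «K2-LIT» (close-out strike line L4
`stub_StCharTS`), h413 = `stmt-HodgeConjecture-24833`, line `K2_E3_EllipticInputs`, unit U4 «Keys», PART «U4Keys» socket :155 (U4f-χ₁-ram-one-d0B)
`sig_K2E3KeysThmTwoContractingRamifiedCharOneDepthZeroNormTrivial` (LINE-LEAD K2E3-plan (g4) EMIT #5, deal D162, cell «U4-RAM»; plan of record K2E3-p06 (g4) DESIGN-M2-v2 (O2),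
the BRANCH-FREE half of steps Z2A-5 ∕ Z2-B «reducible ⟹ an `(I, χ̃)`-type vector killed by every intertwining functional» ASSEMBLED ONCE on `U(Φ₃)(L⁺_v)`).  2026-09-04.
-/
import Summits.HodgeConjecture.HodgeConjecture.Theorems.K2E3BranchAIrreducibleDepthZero    -- ★ Z2A-5 (K2E3-p06 (g4)): the frame + ★ V1, ★ Z2A-2 (dilation), ★ V2b (type vector), ★ letters (iii) (`exists_iwahoriDatum_K_zero_eq_Nbar_eq`, `theta_mul`, `theta_eq_tau_of_mem`, `theta_eq_one_of_map_mem`, `exists_mem_P_mul_of_mem`)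
import HarnessLib

/-!
# K2 ∕ E3 «EllipticInputs», unit U4 «Keys» — (U4f-χ₁-ram-one) at DEPTH ZERO, BRANCH-FREE: A REDUCIBLE `i(χ₁, 1)` OF `U(Φ₃)(L⁺_v)` CONTAINS AN `(I, χ̃)`-TYPE VECTOR `f`,
# `f(1) ≠ 0`, KILLED BY EVERY INTERTWINING FUNCTIONAL `Λ_g(φ) = ∫_N φ(w₀ n g) dn`
# [Casselman1980 §3; Casselman1995 §6.4; Keys1984 §3, §7 Thm (2); MoyPrasad1996 §3; Roche1998 §3–§4]

Cell `pub/hodgecm-mathlib`, crux H413 = `stmt-HodgeConjecture-24833`, route of record `HCCMUnconditional`; chair K2-lead (g2), LINE-LEAD∕dealer K2E3-plan (g4), architect K2E3-p25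
(g3); cell «U4-RAM».  THEOREMS ONLY (no `def`, no `instance`, no `notation`, no named-fact hypothesis, no `sorry`); lane `--supports stmt-HodgeConjecture-24833 --as helper`,
count-neutral.  NOT THE PAYER.

THE POINT.  ★ Z2A-5 `K2E3BranchAIrreducibleDepthZero.false_of_reducible_of_normChar_ne_one` (K2E3-p06 (g4)) runs, INSIDE its proof, the branch-free chain ★ V1 (`V ∋ f`, `f(1) ≠ 0`,
every `Λ_g` vanishes on `V`) → ★ Z2A-3c (iii) Iwahori datum (`K 0 = I`, `N̄ = eA⁻¹N̄_w`) → ★ Z2A-2 dilation (`I ∩ N̄` fixes a dilate in `V`) → ★ V2b (the `(I, χ̃)`-type vector `f′ ∈ V`,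
`f′(1) ≠ 0`), and only THEN uses Branch A.  That chain is what BOTH branches need; this module states its output ONCE as a theorem (and STAGES the two generic applications — `@`-explicit
carrier `U(Φ₃)(L⁺_v)` and inducing character, one argument per `have` — which cuts the elaboration from the ≈ 26 min of the unstaged ★ Z2A-5 form to ≈ 3 min), so that Branch B (★ `K2E3BranchBDeterminantVanishing` + ★ `K2E3BranchBTypeBasisCM`, this seat: `det M = 0`) and any positive-depth or
other-rank re-run become light files:
* **`exists_typeVector_forall_intertwiningIntegral_eq_zero_of_reducible`** — (G3)-frame, `w₀` (matrix `Φ₃`), Haar `μ` on `N`; `v` non-split, `χ₁` continuous ∕ non-unitary ∕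
  contracting ∕ trivial on principal units; `i(χ₁, 1)` reducible ⟹ **`∃ f`, `b·f = χ₁(b₀₀)·f` for `b ∈ I`, `f(1) ≠ 0`, `∫_N f(w₀ n g) dn = 0` for EVERY `g`** (proof = the four ★ steps
  of ★ Z2A-5 verbatim, conclusion read off instead of contradicted).
HONEST LABEL.  HC_CM is proved only modulo the 7 printed citations (2 remaining named inputs: hLiu418 = `stmt-HodgeConjecture-24832`, h413 = `stmt-HodgeConjecture-24833`) until rung 0
closes; count-neutral — this file does NOT pay the leaf; no printed citation is discharged.

## References
* [Casselman1980] W. Casselman, Compositio Math. 40 (1980), §3 (intertwining functionals on Iwahori-type vectors).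
* [Casselman1995] W. Casselman, *Introduction to the theory of admissible representations of `p`-adic reductive groups* (1995), §3.3, §6.4.
* [Keys1984] D. Keys, Compositio Math. 51 (1984), §3, §7 Theorem (2) p. 126.
* [MoyPrasad1996] A. Moy, G. Prasad, Comment. Math. Helv. 71 (1996), §3 (depth-zero types).
* [Roche1998] A. Roche, Ann. Sci. ÉNS (4) 31 (1998), §3–§4.
-/

set_option autoImplicit false
-- the mandated namespace has the single-problem summit's repeated segment (`HodgeConjecture.HodgeConjecture`)
set_option linter.dupNamespace false

noncomputable section

open NumberField IsDedekindDomain MeasureTheory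
open scoped Matrix MatrixGroups WithZero Valued
open Literature.NumberTheory Literature.NumberTheory.Automorphic Literature.NumberTheory.Automorphic.UnitaryGroup
open Literature.NumberTheory.Rogawski1990

namespace Summit.HodgeConjecture.HodgeConjecture.Cruxes.H413.K2E3TypeVectorInKernelDepthZeroCM

open Summit.HodgeConjecture.HodgeConjecture.Cruxes.H413
open Summit.HodgeConjecture.HodgeConjecture.Cruxes.H413.K2E3DepthZeroIwahoriCharacterCM
open Summit.HodgeConjecture.HodgeConjecture.Cruxes.H413.K2E3BranchALettersCM
open Summit.HodgeConjecture.HodgeConjecture.Cruxes.H413.K2E3BranchATorusWitnessCM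
open Summit.HodgeConjecture.HodgeConjecture.Cruxes.H413.K2E3BranchATypeLettersCM

variable (L : Type) [Field L] [NumberField L] [IsCMField L] (v : HeightOneSpectrum (𝓞 ↥(maximalRealSubfield L)))
  (w : PlacesOver L v) (hw : IsCMField.complexConj L • w.1 = w.1)
  (eA : Gqs L v ≃ₜ* ↥(unitaryGroupOfForm (galAdicCompletionMap (L := L) (IsCMField.complexConj L) hw) ((StdForm.antidiagonal 3).over (w.1.adicCompletion L))))
  (heA : ∀ g : Gqs L v,
    ((eA g : ↥(unitaryGroupOfForm (galAdicCompletionMap (L := L) (IsCMField.complexConj L) hw) ((StdForm.antidiagonal 3).over (w.1.adicCompletion L)))) :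
        GL (Fin 3) (w.1.adicCompletion L)) =
      ((localNonsplitEquiv (IsCMField.complexConj L) (qsForm L) (IsCMField.complexConj_ne_one L) w hw g :
        ↥(unitaryGroupOfForm (galAdicCompletionMap (L := L) (IsCMField.complexConj L) hw) (placeForm (qsForm L) w.1))) : GL (Fin 3) (w.1.adicCompletion L)))
  {ϖ : w.1.adicCompletion L} (hϖ : Valued.v ϖ = WithZero.exp (-1 : ℤ))
  (g₁ : GL (Fin 3) (w.1.adicCompletion L)) (hg₁ : (g₁ : Matrix (Fin 3) (Fin 3) (w.1.adicCompletion L)) = Matrix.diagonal ![(1 : w.1.adicCompletion L), 1, ϖ])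
  (K0 K1 I : Subgroup (Gqs L v))
  (hK0 : K0 = ((glInt 3 (w.1.adicCompletion L)).subgroupOf
    (unitaryGroupOfForm (galAdicCompletionMap (L := L) (IsCMField.complexConj L) hw) ((StdForm.antidiagonal 3).over (w.1.adicCompletion L)))).comap
      eA.toMulEquiv.toMonoidHom)
  (hK1 : K1 = (((glInt 3 (w.1.adicCompletion L)).map (MulAut.conj g₁).toMonoidHom).subgroupOf
    (unitaryGroupOfForm (galAdicCompletionMap (L := L) (IsCMField.complexConj L) hw) ((StdForm.antidiagonal 3).over (w.1.adicCompletion L)))).comap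
      eA.toMulEquiv.toMonoidHom)
  (hI : I = K0 ⊓ K1)

/-! ## The `(I, χ̃)`-type vector killed by every `Λ_g` -/

open Classical in
include hw heA hϖ hg₁ hK0 hK1 hI in
set_option maxHeartbeats 4000000 in
set_option synthInstance.maxHeartbeats 400000 in
-- the `SmoothInd` carrier of `cmPrincipalSeries`, ★ V1∕V2b∕Z2A-2 instantiated on `U(Φ₃)(L⁺_v)` (staged applications: ≈ 3 min; the unstaged ★ Z2A-5 form needs ≈ 26 min)
/-- **THE TYPE VECTOR IN THE KERNEL OF EVERY INTERTWINING FUNCTIONAL (depth zero, branch-free).**  `v` non-split, `χ₁` continuous, non-unitary, contracting, trivial on the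
principal units (depth zero); `w₀` the element of matrix `Φ₃`; `μ` a Haar measure on `N(L⁺_v)`.  If `i(χ₁, 1)` is reducible there is `f ∈ i(χ₁, 1)` with `b·f = χ₁(b₀₀)·f` for all
`b ∈ I` (the `(I, χ̃)`-type), `f(1) ≠ 0`, and `∫_N f(w₀ n g) dμ(n) = 0` for EVERY `g`: ★ V1 (`V ∋ f₀`, `f₀(1) ≠ 0`, all `Λ_g|_V = 0`) → ★ (iii) datum (`K 0 = I`, `N̄ = eA⁻¹N̄_w`) → ★ Z2A-2
(dilate fixed by `I ∩ N̄`, in `V`) → ★ V2b with ★ `theta_mul`, `theta_eq_tau_of_mem`, `theta_eq_one_of_map_mem`, `exists_mem_P_mul_of_mem` (`f ∈ V`). [cite: Casselman1980, §3]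
[cite: Casselman1995, §3.3, §6.4] [cite: Keys1984, §3, §7 Theorem (2) p. 126] [cite: MoyPrasad1996, §3] [cite: Roche1998, §3–§4] -/
theorem exists_typeVector_forall_intertwiningIntegral_eq_zero_of_reducible
    (hns : ∀ w' : PlacesOver L v, IsCMField.complexConj L • w'.1 = w'.1)
    (χ₁ : (LocalRing L v)ˣ →* ℂˣ) (h₁ : Continuous fun x => ((χ₁ x : ℂˣ) : ℂ)) (hnu : ∃ x, ‖((χ₁ x : ℂˣ) : ℂ)‖ ≠ 1)
    (hcontr : ∀ x : (LocalRing L v)ˣ, unitModulusChar (LocalRing L v) x < 1 → ‖((χ₁ x : ℂˣ) : ℂ)‖ < 1)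
    (hdepth : ∀ u : (LocalRing L v)ˣ, (∀ w' : PlacesOver L v, Valued.v (((u : LocalRing L v) w') - 1) < 1) → χ₁ u = 1)
    (w₀ : ↥(unitaryGroupOfForm (conjLocal L (IsCMField.complexConj L) v) (cmLocalForm L 3 v))) (hw₀ : Units.val (w₀ : GL (Fin 3) (LocalRing L v)) = cmLocalForm L 3 v)
    [MeasurableSpace ↥(cmBorelTriple L 3 v).N] [BorelSpace ↥(cmBorelTriple L 3 v).N] (μ : Measure ↥(cmBorelTriple L 3 v).N) [μ.IsHaarMeasure]
    (hred : ∃ N : Subrepresentation (cmPrincipalSeries L 3 v (cmTorusCharPair L v χ₁ 1)), N ≠ ⊥ ∧ N ≠ ⊤) :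
    haveI := locallyCompactSpace_cmBorelU L 3 v
    ∃ f : Representation.SmoothInd (cmBorelTriple L 3 v).P
        (Representation.twist (((Representation.trivial ℂ ↥(torusU (conjLocal L (IsCMField.complexConj L) v) (cmLocalForm L 3 v)) ℂ).twist
          (cmTorusCharPair L v χ₁ 1)).comp (cmBorelTriple L 3 v).proj) (rootDeltaChar (cmBorelTriple L 3 v).P)),
      (∀ x ∈ I, Representation.smoothIndRep _ _ x f =
        (if h : IsUnit (((x.val : GL (Fin 3) (LocalRing L v)) : Matrix (Fin 3) (Fin 3) (LocalRing L v)) 0 0) then ((χ₁ h.unit : ℂˣ) : ℂ) else 0) • f) ∧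
      f.toFun 1 ≠ 0 ∧
      ∀ g : ↥(unitaryGroupOfForm (conjLocal L (IsCMField.complexConj L) v) (cmLocalForm L 3 v)),
        ∫ n : ↥(cmBorelTriple L 3 v).N, f.toFun (w₀ * (n : ↥(unitaryGroupOfForm (conjLocal L (IsCMField.complexConj L) v) (cmLocalForm L 3 v))) * g) ∂μ = 0 := by
  haveI := locallyCompactSpace_cmBorelU L 3 v
  -- ★ V1: a `G`-stable `V ∋ f`, `f(1) ≠ 0`, killed by every intertwining functional `Λ_g`
  have h₂ : Continuous fun x : ↥(normOneUnits (conjLocal L (IsCMField.complexConj L) v)) =>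
      (((1 : ↥(normOneUnits (conjLocal L (IsCMField.complexConj L) v)) →* ℂˣ) x : ℂˣ) : ℂ) := by
    simp only [MonoidHom.one_apply]; exact continuous_const
  obtain ⟨V, f, hfV, hf1, hΛ⟩ :=
    K2E3IntertwiningKernelOfReducible.exists_section_apply_one_ne_zero_forall_intertwiningIntegral_eq_zero L v hns χ₁ 1 h₁ h₂ hnu hcontr hred w₀ hw₀ μ
  -- ★ (iii): the Iwahori datum with `K 0 = I`, `N̄ = eA⁻¹(N̄_w)`
  obtain ⟨𝓘, hK0I, hNbar⟩ := exists_iwahoriDatum_K_zero_eq_Nbar_eq L v w hw eA heA hϖ g₁ hg₁ K0 K1 I hK0 hK1 hI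
  subst hK0I
  -- ★ Z2A-2 at level `0`: a dilate of `f` inside `V`, non-zero at `1`, fixed by `I ∩ N̄` — the application is STAGED (`@`-explicit carrier and inducing
  -- character, one argument per `have`): elaborated in one piece with `_` it costs ≈ 7 min of unification (★ Z2A-5 class), staged ≈ seconds
  have d0 := @K2E3IwahoriDatumDilation.exists_dilate_typeReady ↥(unitaryGroupOfForm (conjLocal L (IsCMField.complexConj L) v) (cmLocalForm L 3 v)) _ _ _ (cmBorelTriple L 3 v).P
    (Representation.twist (((Representation.trivial ℂ ↥(torusU (conjLocal L (IsCMField.complexConj L) v) (cmLocalForm L 3 v)) ℂ).twist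
          (cmTorusCharPair L v χ₁ 1)).comp (cmBorelTriple L 3 v).proj) (rootDeltaChar (cmBorelTriple L 3 v).P))
    (cmBorelTriple L 3 v) 𝓘
  have d1 := d0 (cmBorelTriple L 3 v).M_le
  have d2 := d1 V
  have d3 := d2 f
  have d4 := d3 hfV
  have d5 := d4 hf1 0
  obtain ⟨i, hf₁V, hf₁1, hf₁fix⟩ := d5
  -- ★ V2b: the `(I, θ)`-type vector in `V` (staged likewise; ★ letters `exists_mem_P_mul_of_mem`, `theta_mul`, `theta_eq_tau_of_mem`, `theta_eq_one_of_map_mem`)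
  have e0 := @K2E3TypeVectorOfSubrepFactored.exists_typeVector_of_mem_of_factored ↥(unitaryGroupOfForm (conjLocal L (IsCMField.complexConj L) v) (cmLocalForm L 3 v)) _ _ _ (cmBorelTriple L 3 v).P
    (Representation.twist (((Representation.trivial ℂ ↥(torusU (conjLocal L (IsCMField.complexConj L) v) (cmLocalForm L 3 v)) ℂ).twist
          (cmTorusCharPair L v χ₁ 1)).comp (cmBorelTriple L 3 v).proj) (rootDeltaChar (cmBorelTriple L 3 v).P))
    (𝓘.K 0) (𝓘.K 0 ⊓ 𝓘.Nbar) (𝓘.isCompact_K 0)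
  have e1 := e0 (fun b hb => exists_mem_P_mul_of_mem _ 𝓘 0 hb)
  have e2 := e1 (fun g : ↥(unitaryGroupOfForm (conjLocal L (IsCMField.complexConj L) v) (cmLocalForm L 3 v)) => if h : IsUnit (((g : GL (Fin 3) (LocalRing L v)) : Matrix (Fin 3) (Fin 3) (LocalRing L v)) 0 0) then ((χ₁ h.unit : ℂˣ) : ℂ) else 0)
  have e3 := e2 (fun x hx y hy => theta_mul L v w hw eA heA hϖ g₁ hg₁ K0 K1 (𝓘.K 0) hK0 hK1 hI χ₁ hdepth hx hy)
  have e4 := e3 (fun p hp hpI => theta_eq_tau_of_mem L v w hw eA heA hϖ g₁ hg₁ K0 K1 (𝓘.K 0) hK0 hK1 hI χ₁ p hp hpI)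
  have e5 := e4 (fun c hc _ => theta_eq_one_of_map_mem L v w hw eA heA χ₁ (by
      have h := (Subgroup.mem_inf.1 hc).2
      rw [hNbar] at h
      exact h))
  have e6 := e5 V
  have e7 := e6 _ hf₁V
  have e8 := e7 hf₁1
  have e9 := e8 (fun c hc _ => hf₁fix c hc)
  obtain ⟨f', hf'V, hf'1, heig⟩ := e9
  exact ⟨f', heig, hf'1, fun g => hΛ f' hf'V g⟩

end Summit.HodgeConjecture.HodgeConjecture.Cruxes.H413.K2E3TypeVectorInKernelDepthZeroCM

end
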